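import Literature.NumberTheory.EllipticCurves.HeegnerPoints
import Literature.NumberTheory.EllipticCurves.Sha
import Literature.NumberTheory.EllipticCurves.MordellWeil
import HarnessLib

/-!
# Parity of the `2`-Selmer rank over a quadratic field with the Heegner hypothesis
# (Monsky 1996, Lemma 1.4(b) for `F = ℚ`; Kramer 1981)

Topic `Literature/NumberTheory/EllipticCurves` (vocabulary: `SatisfiesHeegnerHypothesis` of
`HeegnerPoints.lean`, `WeierstrassCurve.sha` of `Sha.lean`, `WeierstrassCurve.mordellWeilRank` of
`MordellWeil.lean`, Mathlib's `NumberField.InfinitePlace.nrComplexPlaces`). ONE named fact,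
vendored by the librarian (sweep g23, 2026-08-16, promote event 1727054) from a hypothesis binder
that already occurs VERBATIM in an accepted theorem of the tree: `h14` of
`Literature.NumberTheory.EllipticCurves.monsky_selmerCorank_two_mod_two_eq_of_kramer`
(`BSDSelmerParityMonskyHoffsteinLuoProofs.lean`), the ONLY printed input of Monsky's `2`-parity
theorem over `ℚ` (`monsky_selmerCorank_two_mod_two_eq`, Monsky 1996 Thm. 1.5) that is missing from
the tree — its other four inputs are pre-existing named facts (Modularity, Hoffstein–Luo,
Gross–Zagier–Kolyvagin, Cassels–Tate).

* `Monsky1996_lemma14b_twoSelmerRank_parity` — **Monsky 1996, Lemma 1.4(b), case `F = ℚ`**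
  (p. 417; it is Kramer's parity formula `(−1)^{s₂(E, K)} = ∏_v (−1)^{i_v(E)}`, Kramer 1981 Thm. 1,
  with the local norm indices at the good odd places from Kramer's Prop. 3 and the product
  formula): for an elliptic curve `E/ℚ` (any Weierstrass model `W`, conductor
  `N = W.conductorNorm ℤ`) and a quadratic field `K` in which `2` and every prime dividing `N` split
  (`SatisfiesHeegnerHypothesis 2 K`, `SatisfiesHeegnerHypothesis N K`), the quantity
  `rank E(K) + dim_{𝔽₂} Ш(E/K)[2]` (written with `#Ш(E/K)[2] = 2^u`) has the parity of the number
  `r₂(K)` of complex places of `K` (the number of real places of `ℚ` that do not split in `K`).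

The statement is a theorem in print, NOT proved here (`def … : Prop`, D-0014); its discharge would
be `theorem Monsky1996_lemma14b_twoSelmerRank_parity_holds`, after which
`monsky_selmerCorank_two_mod_two_eq_of_kramer` consumes it as its last argument. Source reading: the
consumer's docstring (provefact seat of `monsky_selmerCorank_two_mod_two_eq`, 2026-08-15/16), which
checked the binder against Monsky p. 417 and Kramer Thm. 1 / Prop. 3.

## References

* P. Monsky, *Generalizing the Birch–Stephens theorem. I. Modular curves*, Math. Z. 221 (1996),
  415–420, Lemma 1.4(b) and Thm. 1.5 (p. 417). [Monsky1996]
* K. Kramer, *Arithmetic of elliptic curves upon quadratic extension*, Trans. Amer. Math. Soc.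
  264 (1981), 121–135, Thm. 1 and Prop. 3. [Kramer1981]
-/

open scoped AddSubgroup

open WeierstrassCurve NumberField NumberField.InfinitePlace

namespace Literature.NumberTheory.EllipticCurves

/-- **Monsky 1996, Lemma 1.4(b) for `F = ℚ` (Kramer 1981, Thm. 1 with Prop. 3 and the product
formula)**: for an elliptic `W/ℚ` and a quadratic field `K` in which `2` and all primes dividing
the conductor `N_W` split, `rank W(K) + dim_{𝔽₂} Ш(W/K)[2] ≡ r₂(K) (mod 2)` (with
`#Ш(W/K)[2] = 2^u`, `r₂(K)` = number of complex places). VERBATIM the hypothesis `h14` of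
`monsky_selmerCorank_two_mod_two_eq_of_kramer`. [cite: Monsky1996, Lemma 1.4(b) (p. 417)]
[cite: Kramer1981, Thm. 1 and Prop. 3] -/
def Monsky1996_lemma14b_twoSelmerRank_parity : Prop :=
  ∀ (W : WeierstrassCurve ℚ) [W.IsElliptic] (K : Type) [Field K] [NumberField K],
    Module.finrank ℚ K = 2 → SatisfiesHeegnerHypothesis 2 K →
      SatisfiesHeegnerHypothesis (W.conductorNorm ℤ) K →
        ∀ u : ℕ, Nat.card (((W.baseChange K).sha)[(2 : ℤ)]) = 2 ^ u →
          ((W.baseChange K).mordellWeilRank + u) % 2 = nrComplexPlaces K % 2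

end Literature.NumberTheory.EllipticCurves
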